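import Literature.LinearAlgebra.Matrix.IntegerLinearSolvability
import Literature.Computability.Complexity.ModularSolverFP
import Literature.Computability.Complexity.RowSelectFP
import HarnessLib

/-!
# Solvability of systems of linear Diophantine equations is decidable in polynomial time

Topic `Literature/Computability/Complexity`; the machine side of
`Literature/LinearAlgebra/Matrix/IntegerLinearSolvability.lean`.  The decision procedure
`IntSolve.intSolvable D c A b` (greedy selection of independent augmented rows by Gram determinants,
the rank test on the coefficient parts, then diagonalisation modulo `|det (A_S A_Sᵀ)|`) is run with
the polynomial-time integer determinant `IntDetFP.detZ` (`DeterminantFP.lean`) by a polynomial-time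
string function on the code `⟨c, A, b⟩` (binary `c`, raw list of rows of canonical integer codes,
raw list of integers):

* `aug_codeFP`, `coefs_codeFP`, `modN_codeFP` (the Gram/independence/greedy bricks are reused from
  `RowSelectFP.lean`, the entrywise reduction `S.map (residues N)` is `IntDetFP.reduce_codeFP` of
  `DeterminantFP.lean`);
* **`intSolvable_codeFP : CodeFP (pairE natE (pairE zmatE (rawE intE))) bitE (fun t => intSolvable detZ t.1 t.2.1 t.2.2)`**;
* **`intSolvable_detZ_iff`** (with `RowSelectFP.detCorrect_detZ`): on `⟨c, rows A, List.ofFn b⟩` the computed bit is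
  `[∃ x ∈ ℤᶜ, A x = b]` — together, the polynomial-time decidability of linear Diophantine systems
  (Kannan–Bachem 1979) in the form the cohomological `k`-consistency algorithm needs
  (Ó Conghaile 2022, §4.2).

## References

* R. Kannan, A. Bachem, *Polynomial algorithms for computing the Smith and Hermite normal forms of
  an integer matrix*, SIAM J. Comput. 8 (1979) 499–507 [KannanBachem1979] (the result).
* A. Schrijver, *Theory of Linear and Integer Programming*, Wiley 1986, §5.3 [Schrijver1986] (the
  modular method).
* S. Arora, B. Barak, *Computational Complexity: A Modern Approach*, CUP 2009, §1.3 [AroraBarak2009].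
-/

namespace Literature.Computability.Complexity

namespace IntSolveFP

open CodeFP Polynomial _root_.Computability Literature.LinearAlgebra.Matrix
  Literature.LinearAlgebra.Matrix.Berkowitz Literature.LinearAlgebra.Matrix.RowSelect
  Literature.LinearAlgebra.Matrix.ModDiag Literature.LinearAlgebra.Matrix.IntSolve ModDiagFP IntDetFP RowSelectFP

/-- Integer rows. -/
local notation "rowZ" => rawE intE

/-- Integer matrices: raw lists of rows of canonical integer codes. -/
local notation "zmatE" => rawE (rawE intE)

/-- Budgets: raw lists of units. -/
local notation "budE" => rawE unitE

/-! ### Augmented rows (dot products, Gram matrices, the independence test and the greedy scan on codes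
are `RowSelectFP.idot_codeFP`, `gram_codeFP`, `indepTest_codeFP`, `greedy_codeFP`) -/

/-- **`aug` on codes**: `(A, b) ↦ zipWith (· ++ [·]) A b`. [cite: AroraBarak2009, §1.3] -/
theorem aug_codeFP : CodeFP (pairE zmatE (rawE intE)) zmatE (fun t => aug t.1 t.2) := by
  have hg : CodeFP (pairE unitE (pairE rowZ intE)) rowZ (fun t => t.2.1 ++ [t.2.2]) :=
    (rawAppend intE).comp ((snd _ _).fst'.pair ((rawSingleton intE).comp (snd _ _).snd'))
  have hz := zipWith (σ := Unit) (eσ := unitE) (eα := rowZ) (eβ := intE) (eγ := rowZ) hg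
  exact (hz.comp ((const _ ()).pair (CodeFP.id _))).congr fun _ => rfl

/-! ### Coefficient parts and the modulus (the residues `S.map (residues N)` on codes are
`IntDetFP.reduce_codeFP`, `residues N` unfolding to `(·.map (zmodNat N))`) -/

/-- **`coefs` on codes**: `(c, S) ↦ S.map (take c)` (by the unary `min c |row|`). [cite: AroraBarak2009, §1.3] -/
theorem coefs_codeFP : CodeFP (pairE natE zmatE) zmatE (fun t => coefs t.1 t.2) := by
  have htake : CodeFP (pairE natE rowZ) rowZ (fun t => t.2.take t.1) :=
    ((rawTakeUn intE).comp ((unOfNatMin.comp (((ulength intE).comp (snd _ _)).pair (fst _ _))).pair (snd _ _))).congr fun t => by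
      simp only; rw [← List.take_eq_take_min]
  exact (map (σ := ℕ) (eσ := natE) (eα := rowZ) (g := fun t => t.2.take t.1) htake).congr fun _ => rfl

/-- **`modN detZ` on codes**: `(c, S) ↦ |detZ (gram (coefs c S))| - 1`. [cite: AroraBarak2009, §1.3] -/
theorem modN_codeFP : CodeFP (pairE natE zmatE) natE (fun t => modN detZ t.1 t.2) :=
  (natSub.comp ((intNatAbs.comp (detZ_codeFP.comp (gram_codeFP.comp coefs_codeFP))).pair (const _ 1))).congr fun _ => rfl

/-! ### The decision procedure -/

/-- **`intSolvable detZ` is polynomial-time on codes**: `(c, A, b) ↦ intSolvable detZ c A b`.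
[cite: KannanBachem1979, Thm. 4 (result); Schrijver1986, §5.3 (method); AroraBarak2009, §1.3] -/
theorem intSolvable_codeFP : CodeFP (pairE natE (pairE zmatE (rawE intE))) bitE (fun t => intSolvable detZ t.1 t.2.1 t.2.2) := by
  let tE := pairE natE (pairE zmatE (rawE intE))
  have pc : CodeFP tE natE (fun t => t.1) := fst _ _
  have hS : CodeFP tE zmatE (fun t => sel detZ t.1 t.2.1 t.2.2) :=
    (greedy_codeFP.comp ((natAdd.comp (pc.pair (const _ 1))).pair (aug_codeFP.comp (snd _ _)))).congr fun _ => rfl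
  -- (every `comp` is re-targeted with `congr … rfl`: ascribing the composed form directly makes the
  -- unifier unfold `modN`/`detZ` symbolically, which does not terminate in time)
  have hN : CodeFP tE natE (fun t => modN detZ t.1 (sel detZ t.1 t.2.1 t.2.2)) := (modN_codeFP.comp (pc.pair hS)).congr fun _ => rfl
  have hind : CodeFP tE bitE (fun t => indepTest detZ (coefs t.1 (sel detZ t.1 t.2.1 t.2.2))) :=
    (indepTest_codeFP.comp (coefs_codeFP.comp (pc.pair hS))).congr fun _ => rfl
  -- budgets: `2 |bin N| + 1`, `|bin N|`, `|S| + 1`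
  have hlen : CodeFP tE unE (fun t => (natE (modN detZ t.1 (sel detZ t.1 t.2.1 t.2.2))).length) :=
    (strLength.comp (strOfNat.comp hN)).congr fun _ => rfl
  have h2len : CodeFP tE unE (fun t => 2 * (natE (modN detZ t.1 (sel detZ t.1 t.2.1 t.2.2))).length + 1) :=
    (unSucc.comp (unAdd.comp (hlen.pair hlen))).congr fun t => by simp only [two_mul]
  have hbF : CodeFP tE budE (fun t => List.replicate (2 * (natE (modN detZ t.1 (sel detZ t.1 t.2.1 t.2.2))).length + 1) ()) :=
    (replicateUnit.comp h2len).congr fun _ => rfl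
  have hbR : CodeFP tE budE (fun t => List.replicate (natE (modN detZ t.1 (sel detZ t.1 t.2.1 t.2.2))).length ()) :=
    (replicateUnit.comp hlen).congr fun _ => rfl
  have hbP : CodeFP tE budE (fun t => List.replicate ((sel detZ t.1 t.2.1 t.2.2).length + 1) ()) :=
    (replicateUnit.comp (unSucc.comp ((ulength (rawE intE)).comp hS))).congr fun _ => rfl
  have hres : CodeFP tE (rawE (rawE natE)) (fun t => (sel detZ t.1 t.2.1 t.2.2).map (residues (modN detZ t.1 (sel detZ t.1 t.2.1 t.2.2)))) :=
    (reduce_codeFP.comp (hN.pair hS)).congr fun _ => rfl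
  have hst : CodeFP tE (pairE (pairE natE (rawE (rawE natE))) bitE)
      (fun t => ((t.1, (sel detZ t.1 t.2.1 t.2.2).map (residues (modN detZ t.1 (sel detZ t.1 t.2.1 t.2.2)))), true)) :=
    (pc.pair hres).pair (const _ true)
  have hsolve := solve_codeFP.comp (((hN.pair (hbF.pair hbR)).pair hst).pair hbP)
  refine ((hind.and hsolve).congr fun t => ?_)
  simp only [List.length_replicate, ModDiagFP.length_natE_eq_size, intSolvable]

/-- **Linear Diophantine systems are decided in polynomial time**: the polynomial-time string
function of `intSolvable_codeFP`, run on `⟨c, rows A, b⟩`, answers `[∃ x ∈ ℤᶜ, A x = b]`.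
[cite: KannanBachem1979, Thm. 4; Schrijver1986, Cor. 5.3b] -/
theorem intSolvable_detZ_iff {m c : ℕ} (A : _root_.Matrix (Fin m) (Fin c) ℤ) (b : Fin m → ℤ) :
    intSolvable detZ c (rows A) (List.ofFn b) = true ↔ ∃ x : Fin c → ℤ, A.mulVec x = b :=
  intSolvable_iff detCorrect_detZ A b

end IntSolveFP

end Literature.Computability.Complexity
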